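import Mathlib.MeasureTheory.Integral.RieszMarkovKakutani.Real
import Mathlib.Topology.UrysohnsLemma
import Mathlib.Data.Real.Pointwise
import HarnessLib

/-!
# Bounded functionals on `C_c(X)` are differences of two finite Radon measures

Support file for the discharge of the named fact
`Literature.Barriers.AnomalousDissipation.DeRosaInversi2024_thm12` (`CodimensionOneRigidity.lean`).
The structure step of the proof (De Rosa–Inversi 2024, §4: "we have used the Radon–Nikodym
theorem to decompose the matrix-valued measure `∇u(·,t)` with respect to its variation") needs
the distributional gradient of a `BV` field as a genuine (matrix of) Radon measure(s). Mathlib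
(this pin) has the Riesz–Markov–Kakutani theorem for *positive* functionals on `C_c(X, ℝ)`
(`RealRMK.integral_rieszMeasure`) but no signed version; this file supplies the classical
reduction (Rudin, *Real and Complex Analysis*, Thm. 6.19, first step; Evans–Gariepy §1.8,
Thm. 1): a linear functional `Λ` on `C_c(X, ℝ)` with `|Λ f| ≤ C sup |f|` is dominated by its
**total variation functional** `V(θ) = sup {Λ φ : |φ| ≤ θ}`, which is additive and positively
homogeneous on nonnegative functions, so that `V ± Λ` are positive functionals and
`2Λ f = ∫ f dμ₊ - ∫ f dμ₋` with `μ_± = rieszMeasure (V ± Λ)`, finite of mass `≤ 2C`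
(`exists_measure_sub_measure_of_bounded`). Everything is proved; theorems only.

## References

* W. Rudin, *Real and Complex Analysis*, 3rd ed., Thm. 6.19 (and §6.1–6.2 on total variation).
* L. C. Evans, R. F. Gariepy, *Measure Theory and Fine Properties of Functions*, §1.8, Thm. 1.
* L. De Rosa, M. Inversi, Comm. Math. Phys. 405 (2024), §2.2 and §4 (arXiv:2307.09189).
-/

noncomputable section

open MeasureTheory Set Function Filter Topology CompactlySupported NNReal
open scoped ENNReal NNReal Pointwise

namespace Literature.Barriers.AnomalousDissipation

namespace CodimensionOneRigidity

variable {X : Type*} [TopologicalSpace X]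

/-! ### Clamping: the Riesz decomposition property of `C_c(X, ℝ)` -/

/-- **Riesz decomposition in `C_c(X, ℝ)`**: if `|φ| ≤ θ₁ + θ₂` pointwise with `θ₁, θ₂ ≥ 0`
continuous and compactly supported, then `φ = φ₁ + φ₂` with `φᵢ ∈ C_c` and `|φᵢ| ≤ θᵢ`
(clamp `φ` to `[-θ₁, θ₁]`; Rudin, RCA, proof of Thm. 6.19 uses the analogous splitting). [folklore] -/
theorem exists_add_eq_of_abs_le_add (φ : C_c(X, ℝ)) (θ₁ θ₂ : C_c(X, ℝ≥0))
    (h : ∀ x, |φ x| ≤ (θ₁ x : ℝ) + θ₂ x) :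
    ∃ φ₁ φ₂ : C_c(X, ℝ), φ = φ₁ + φ₂ ∧ (∀ x, |φ₁ x| ≤ (θ₁ x : ℝ)) ∧ ∀ x, |φ₂ x| ≤ (θ₂ x : ℝ) := by
  refine ⟨(φ ⊓ θ₁.toReal) ⊔ (-θ₁.toReal), φ - ((φ ⊓ θ₁.toReal) ⊔ (-θ₁.toReal)),
    (add_sub_cancel _ _).symm, fun x => ?_, fun x => ?_⟩
  · have ht : (0 : ℝ) ≤ θ₁ x := NNReal.coe_nonneg _
    simp only [CompactlySupportedContinuousMap.sup_apply,
      CompactlySupportedContinuousMap.inf_apply, CompactlySupportedContinuousMap.neg_apply,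
      CompactlySupportedContinuousMap.toReal_apply]
    rw [abs_le]
    refine ⟨le_sup_right, sup_le inf_le_right (by linarith)⟩
  · have ht : (0 : ℝ) ≤ θ₁ x := NNReal.coe_nonneg _
    have hs : (0 : ℝ) ≤ θ₂ x := NNReal.coe_nonneg _
    have hx := abs_le.1 (h x)
    simp only [CompactlySupportedContinuousMap.sub_apply,
      CompactlySupportedContinuousMap.sup_apply, CompactlySupportedContinuousMap.inf_apply,
      CompactlySupportedContinuousMap.neg_apply, CompactlySupportedContinuousMap.toReal_apply]
    rw [abs_le]
    rcases le_total (φ x) (θ₁ x) with h1 | h1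
    · rw [inf_eq_left.2 h1]
      rcases le_total (φ x) (-(θ₁ x : ℝ)) with h2 | h2
      · rw [sup_eq_right.2 h2]; constructor <;> linarith
      · rw [sup_eq_left.2 h2]; constructor <;> linarith
    · rw [inf_eq_right.2 h1, sup_eq_left.2 (by linarith)]
      constructor <;> linarith

/-! ### The total variation functional of a bounded functional -/

section Variation

variable (Λ : C_c(X, ℝ) →ₗ[ℝ] ℝ) {C : ℝ}

/-- A nonnegative continuous compactly supported function is bounded. [folklore] -/
theorem exists_forall_coe_le (θ : C_c(X, ℝ≥0)) : ∃ M : ℝ, 0 ≤ M ∧ ∀ x, (θ x : ℝ) ≤ M := by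
  obtain ⟨M, hM⟩ := (map_continuous θ.toReal).bounded_above_of_compact_support
    θ.toReal.hasCompactSupport
  refine ⟨max M 0, le_max_right _ _, fun x => ?_⟩
  have h := hM x
  rw [CompactlySupportedContinuousMap.toReal_apply, Real.norm_eq_abs,
    abs_of_nonneg (NNReal.coe_nonneg _)] at h
  exact h.trans (le_max_left _ _)

/-- The set `{Λ φ : |φ| ≤ θ}` whose supremum is the total variation `V(θ)`: it contains `0`,
and under the bound `|Λ f| ≤ C sup|f|` it is bounded above by `C M` whenever `θ ≤ M`. [folklore] -/
theorem variationSet_bddAbove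
    (hΛ : ∀ (f : C_c(X, ℝ)) (M : ℝ), (∀ x, |f x| ≤ M) → |Λ f| ≤ C * M) (θ : C_c(X, ℝ≥0))
    {M : ℝ} (hM : ∀ x, (θ x : ℝ) ≤ M) :
    ∀ a ∈ (fun φ => Λ φ) '' {φ : C_c(X, ℝ) | ∀ x, |φ x| ≤ (θ x : ℝ)}, a ≤ C * M := by
  rintro a ⟨φ, hφ, rfl⟩
  exact (le_abs_self _).trans (hΛ φ M fun x => (hφ x).trans (hM x))

/-- `0` belongs to the variation set. [folklore] -/
theorem zero_mem_variationSet (θ : C_c(X, ℝ≥0)) :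
    (0 : ℝ) ∈ (fun φ => Λ φ) '' {φ : C_c(X, ℝ) | ∀ x, |φ x| ≤ (θ x : ℝ)} :=
  ⟨0, fun x => by simp, by simp⟩

variable {Λ}
variable {V : C_c(X, ℝ≥0) → ℝ}

/-- Admissible test functions are bounded by the variation: `|φ| ≤ θ ⟹ Λ φ ≤ V θ`. [folklore] -/
theorem le_variation
    (hV : ∀ θ, IsLUB ((fun φ => Λ φ) '' {φ : C_c(X, ℝ) | ∀ x, |φ x| ≤ (θ x : ℝ)}) (V θ))
    {θ : C_c(X, ℝ≥0)} {φ : C_c(X, ℝ)} (hφ : ∀ x, |φ x| ≤ (θ x : ℝ)) : Λ φ ≤ V θ :=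
  (hV θ).1 ⟨φ, hφ, rfl⟩

/-- `|Λ φ| ≤ V θ` for admissible `φ` (apply `le_variation` to `±φ`). [folklore] -/
theorem abs_le_variation
    (hV : ∀ θ, IsLUB ((fun φ => Λ φ) '' {φ : C_c(X, ℝ) | ∀ x, |φ x| ≤ (θ x : ℝ)}) (V θ))
    {θ : C_c(X, ℝ≥0)} {φ : C_c(X, ℝ)} (hφ : ∀ x, |φ x| ≤ (θ x : ℝ)) : |Λ φ| ≤ V θ := by
  rw [abs_le]
  refine ⟨?_, le_variation hV hφ⟩
  have h := le_variation hV (θ := θ) (φ := -φ) fun x => by simpa using hφ x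
  rw [map_neg] at h
  linarith

/-- The variation is nonnegative. [folklore] -/
theorem variation_nonneg
    (hV : ∀ θ, IsLUB ((fun φ => Λ φ) '' {φ : C_c(X, ℝ) | ∀ x, |φ x| ≤ (θ x : ℝ)}) (V θ))
    (θ : C_c(X, ℝ≥0)) : 0 ≤ V θ :=
  (hV θ).1 (zero_mem_variationSet Λ θ)

/-- The variation is bounded by the functional bound: `θ ≤ M ⟹ V θ ≤ C M`. [folklore] -/
theorem variation_le
    (hΛ : ∀ (f : C_c(X, ℝ)) (M : ℝ), (∀ x, |f x| ≤ M) → |Λ f| ≤ C * M)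
    (hV : ∀ θ, IsLUB ((fun φ => Λ φ) '' {φ : C_c(X, ℝ) | ∀ x, |φ x| ≤ (θ x : ℝ)}) (V θ))
    (θ : C_c(X, ℝ≥0)) {M : ℝ} (hM : ∀ x, (θ x : ℝ) ≤ M) : V θ ≤ C * M :=
  (hV θ).2 (variationSet_bddAbove Λ hΛ θ hM)

/-- `V 0 = 0`. [folklore] -/
theorem variation_zero
    (hV : ∀ θ, IsLUB ((fun φ => Λ φ) '' {φ : C_c(X, ℝ) | ∀ x, |φ x| ≤ (θ x : ℝ)}) (V θ)) :
    V 0 = 0 := by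
  refine le_antisymm ((hV 0).2 ?_) (variation_nonneg hV 0)
  rintro a ⟨φ, hφ, rfl⟩
  have h0 : φ = 0 := by
    ext x
    have := hφ x
    simp only [CompactlySupportedContinuousMap.zero_apply, NNReal.coe_zero, abs_nonpos_iff] at this
    simpa using this
  simp [h0]

/-- **Additivity of the total variation** on nonnegative functions (Rudin, RCA, Thm. 6.19, the
step "`λ` is additive on `C_c⁺`", via the Riesz decomposition `exists_add_eq_of_abs_le_add`). [folklore] -/
theorem variation_add
    (hV : ∀ θ, IsLUB ((fun φ => Λ φ) '' {φ : C_c(X, ℝ) | ∀ x, |φ x| ≤ (θ x : ℝ)}) (V θ))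
    (θ₁ θ₂ : C_c(X, ℝ≥0)) : V (θ₁ + θ₂) = V θ₁ + V θ₂ := by
  refine le_antisymm ((hV _).2 ?_) ?_
  · rintro a ⟨φ, hφ, rfl⟩
    obtain ⟨φ₁, φ₂, rfl, h₁, h₂⟩ := exists_add_eq_of_abs_le_add φ θ₁ θ₂ fun x => by
      simpa using hφ x
    show Λ (φ₁ + φ₂) ≤ V θ₁ + V θ₂
    rw [map_add]
    exact add_le_add (le_variation hV h₁) (le_variation hV h₂)
  · -- `V θ₁ ≤ V (θ₁ + θ₂) - Λ φ₂` for every admissible `φ₂`, then take the sup over `φ₂`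
    have key : ∀ φ₂ : C_c(X, ℝ), (∀ x, |φ₂ x| ≤ (θ₂ x : ℝ)) → V θ₁ ≤ V (θ₁ + θ₂) - Λ φ₂ := by
      intro φ₂ h₂
      refine (hV θ₁).2 ?_
      rintro a ⟨φ₁, h₁, rfl⟩
      show Λ φ₁ ≤ _
      have hsum : ∀ x, |(φ₁ + φ₂) x| ≤ ((θ₁ + θ₂) x : ℝ) := fun x => by
        simp only [CompactlySupportedContinuousMap.add_apply, NNReal.coe_add]
        exact (abs_add_le _ _).trans (add_le_add (h₁ x) (h₂ x))
      have := le_variation hV hsum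
      rw [map_add] at this
      linarith
    have key' : V θ₂ ≤ V (θ₁ + θ₂) - V θ₁ := by
      refine (hV θ₂).2 ?_
      rintro a ⟨φ₂, h₂, rfl⟩
      show Λ φ₂ ≤ _
      have := key φ₂ h₂
      linarith
    linarith

/-- **Positive homogeneity of the total variation**: `V (c • θ) = c V θ` for `c ≥ 0`. [folklore] -/
theorem variation_smul
    (hV : ∀ θ, IsLUB ((fun φ => Λ φ) '' {φ : C_c(X, ℝ) | ∀ x, |φ x| ≤ (θ x : ℝ)}) (V θ))
    (c : ℝ≥0) (θ : C_c(X, ℝ≥0)) : V (c • θ) = c * V θ := by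
  rcases eq_or_lt_of_le c.2 with hc | hc
  · have hc0 : c = 0 := Subtype.ext hc.symm
    subst hc0
    rw [zero_smul, variation_zero hV, NNReal.coe_zero, zero_mul]
  · have hc' : (0 : ℝ) < c := hc
    refine le_antisymm ((hV _).2 ?_) ?_
    · rintro a ⟨φ, hφ, rfl⟩
      have hadm : ∀ x, |((c : ℝ)⁻¹ • φ) x| ≤ (θ x : ℝ) := fun x => by
        have h1 := hφ x
        rw [CompactlySupportedContinuousMap.smul_apply, smul_eq_mul, NNReal.coe_mul] at h1
        rw [CompactlySupportedContinuousMap.smul_apply, smul_eq_mul, abs_mul,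
          abs_of_pos (inv_pos.2 hc'), inv_mul_le_iff₀ hc']
        exact h1
      have h := le_variation hV hadm
      rw [map_smul, smul_eq_mul, inv_mul_le_iff₀ hc'] at h
      exact h
    · rw [← le_div_iff₀' hc']
      refine (hV θ).2 ?_
      rintro a ⟨φ, hφ, rfl⟩
      show Λ φ ≤ _
      rw [le_div_iff₀' hc']
      have hadm : ∀ x, |((c : ℝ) • φ) x| ≤ ((c • θ) x : ℝ) := fun x => by
        rw [CompactlySupportedContinuousMap.smul_apply, smul_eq_mul,
          CompactlySupportedContinuousMap.smul_apply, smul_eq_mul, NNReal.coe_mul, abs_mul,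
          abs_of_pos hc']
        exact mul_le_mul_of_nonneg_left (hφ x) hc'.le
      have h := le_variation hV hadm
      rwa [map_smul, smul_eq_mul] at h

end Variation

/-! ### The decomposition `2Λ = μ₊ - μ₋` -/

variable [T2Space X] [LocallyCompactSpace X] [MeasurableSpace X] [BorelSpace X]

/-- The Riesz measure of a positive functional dominated by `B` on `0 ≤ f ≤ 1` has total mass
`≤ B` (inner regularity on the open set `univ` and `rieszMeasure_le_of_eq_one` with Urysohn
functions of the compact sets). [folklore] -/
theorem rieszMeasure_univ_le (P : C_c(X, ℝ) →ₚ[ℝ] ℝ) {B : ℝ}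
    (hP : ∀ f : C_c(X, ℝ), (∀ x, f x ∈ Icc (0 : ℝ) 1) → P f ≤ B) :
    RealRMK.rieszMeasure P univ ≤ ENNReal.ofReal B := by
  refine le_of_forall_lt fun r hr => ?_
  obtain ⟨K, -, hK, hrK⟩ := isOpen_univ.exists_lt_isCompact hr
  obtain ⟨f, hf1, -, hfc, hf01⟩ := exists_continuous_one_zero_of_isCompact hK isClosed_empty
    (disjoint_empty K)
  set g : C_c(X, ℝ) := ⟨f, hfc⟩ with hg
  have hle := RealRMK.rieszMeasure_le_of_eq_one P (f := g) (fun x => (hf01 x).1) hK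
    (fun x hx => hf1 hx)
  exact hrK.trans_le (hle.trans (ENNReal.ofReal_le_ofReal (hP g hf01)))

/-- **Bounded functionals on `C_c(X, ℝ)` are differences of finite Radon measures** (Rudin, RCA,
Thm. 6.19, first step; the form of the Riesz representation of `(C_c)'` needed to turn a `BV`
gradient, given as a functional on test functions, into a matrix of Radon measures as in
De Rosa–Inversi 2024, §2.2 and §4): if `Λ : C_c(X, ℝ) →ₗ ℝ` satisfies `|Λ f| ≤ C M` whenever
`|f| ≤ M`, then there are regular measures `μ₁, μ₂` of mass `≤ 2C` with
`2 Λ f = ∫ f dμ₁ - ∫ f dμ₂` for all `f ∈ C_c(X, ℝ)`. [folklore] -/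
theorem exists_measure_sub_measure_of_bounded (Λ : C_c(X, ℝ) →ₗ[ℝ] ℝ) {C : ℝ}
    (hΛ : ∀ (f : C_c(X, ℝ)) (M : ℝ), (∀ x, |f x| ≤ M) → |Λ f| ≤ C * M) :
    ∃ μ₁ μ₂ : Measure X, μ₁.Regular ∧ μ₂.Regular ∧
      μ₁ univ ≤ ENNReal.ofReal (2 * C) ∧ μ₂ univ ≤ ENNReal.ofReal (2 * C) ∧
      ∀ f : C_c(X, ℝ), 2 * Λ f = (∫ x, f x ∂μ₁) - ∫ x, f x ∂μ₂ := by
  -- the total variation functional on `C_c⁺`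
  set S : C_c(X, ℝ≥0) → Set ℝ := fun θ =>
    (fun φ => Λ φ) '' {φ : C_c(X, ℝ) | ∀ x, |φ x| ≤ (θ x : ℝ)} with hS
  set V : C_c(X, ℝ≥0) → ℝ := fun θ => sSup (S θ) with hVdef
  have hV : ∀ θ, IsLUB (S θ) (V θ) := fun θ => by
    obtain ⟨M, -, hM⟩ := exists_forall_coe_le θ
    exact isLUB_csSup ⟨0, zero_mem_variationSet Λ θ⟩ ⟨C * M, variationSet_bddAbove Λ hΛ θ hM⟩
  -- `V` as an `ℝ≥0`-linear map on `C_c(X, ℝ≥0)`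
  set W : C_c(X, ℝ≥0) →ₗ[ℝ≥0] ℝ≥0 :=
    { toFun := fun θ => ⟨V θ, variation_nonneg hV θ⟩
      map_add' := fun θ₁ θ₂ => NNReal.eq (by
        rw [NNReal.coe_add]
        exact variation_add hV θ₁ θ₂)
      map_smul' := fun c θ => NNReal.eq (by
        rw [RingHom.id_apply, smul_eq_mul, NNReal.coe_mul]
        exact variation_smul hV c θ) } with hW
  have hW' : ∀ θ : C_c(X, ℝ≥0), (W θ : ℝ) = V θ := fun θ => rfl
  -- its positive extension `P` to `C_c(X, ℝ)`; on nonnegative `f`, `P f = V f`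
  set P : C_c(X, ℝ) →ₚ[ℝ] ℝ := CompactlySupportedContinuousMap.toRealPositiveLinear W with hP
  have hPnn : ∀ f : C_c(X, ℝ), 0 ≤ f → P f = V f.nnrealPart := by
    intro f hf
    rw [hP, CompactlySupportedContinuousMap.toRealPositiveLinear_apply,
      CompactlySupportedContinuousMap.nnrealPart_neg_eq_zero_of_nonneg hf, map_zero]
    simp [hW']
  have hnn : ∀ f : C_c(X, ℝ), 0 ≤ f → ∀ x, |f x| ≤ (f.nnrealPart x : ℝ) := by
    intro f hf x
    have hx : 0 ≤ f x := hf x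
    rw [CompactlySupportedContinuousMap.nnrealPart_apply, Real.coe_toNNReal _ hx, abs_of_nonneg hx]
  -- the two positive functionals `P ± Λ`
  have hpos₁ : ∀ f : C_c(X, ℝ), 0 ≤ f → 0 ≤ (P.toLinearMap + Λ) f := by
    intro f hf
    have h := abs_le_variation hV (hnn f hf)
    rw [LinearMap.add_apply]
    change 0 ≤ P f + Λ f
    rw [hPnn f hf]
    linarith [neg_abs_le (Λ f)]
  have hpos₂ : ∀ f : C_c(X, ℝ), 0 ≤ f → 0 ≤ (P.toLinearMap - Λ) f := by
    intro f hf
    have h := abs_le_variation hV (hnn f hf)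
    rw [LinearMap.sub_apply]
    change 0 ≤ P f - Λ f
    rw [hPnn f hf]
    linarith [le_abs_self (Λ f)]
  set Q₁ : C_c(X, ℝ) →ₚ[ℝ] ℝ := PositiveLinearMap.mk₀ (P.toLinearMap + Λ) hpos₁ with hQ₁
  set Q₂ : C_c(X, ℝ) →ₚ[ℝ] ℝ := PositiveLinearMap.mk₀ (P.toLinearMap - Λ) hpos₂ with hQ₂
  have hQ₁' : ∀ f, Q₁ f = P f + Λ f := fun f => rfl
  have hQ₂' : ∀ f, Q₂ f = P f - Λ f := fun f => rfl
  -- mass bounds: `Qᵢ f ≤ 2C` for `0 ≤ f ≤ 1`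
  have hmass : ∀ f : C_c(X, ℝ), (∀ x, f x ∈ Icc (0 : ℝ) 1) → P f ≤ C ∧ |Λ f| ≤ C := by
    intro f hf
    have hf0 : 0 ≤ f := fun x => (hf x).1
    refine ⟨?_, ?_⟩
    · rw [hPnn f hf0]
      have := variation_le hΛ hV f.nnrealPart (M := 1) fun x => by
        rw [CompactlySupportedContinuousMap.nnrealPart_apply, Real.coe_toNNReal _ (hf x).1]
        exact (hf x).2
      simpa using this
    · have := hΛ f 1 fun x => by rw [abs_of_nonneg (hf x).1]; exact (hf x).2
      simpa using this
  refine ⟨RealRMK.rieszMeasure Q₁, RealRMK.rieszMeasure Q₂, inferInstance, inferInstance,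
    rieszMeasure_univ_le Q₁ fun f hf => ?_, rieszMeasure_univ_le Q₂ fun f hf => ?_, fun f => ?_⟩
  · rw [hQ₁']
    have := hmass f hf
    linarith [le_abs_self (Λ f)]
  · rw [hQ₂']
    have := hmass f hf
    linarith [neg_abs_le (Λ f)]
  · rw [RealRMK.integral_rieszMeasure, RealRMK.integral_rieszMeasure, hQ₁', hQ₂']
    ring

end CodimensionOneRigidity

end Literature.Barriers.AnomalousDissipation

end
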